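import Summits.RiemannHypothesis.RiemannHypothesis.Theses.DisplacementPencil
import Summits.RiemannHypothesis.RiemannHypothesis.Theorems.PencilDoubling.Negative.DisplacementPencilPencilDoublingTargetOrBust

/-!
# `DisplacementPencil.PencilDoubling` (crux, item stmt-RiemannHypothesis-17887): the crux is the
route TARGET in costume, and the target is at least the summit

Redirect-strategist census artefact (r1, 2026-08-17) for the deciding crux `PencilDoubling` of route
`RiemannHypothesis/DisplacementPencil`.  Write `Hyp c` for "the rung `P_c = c·Ξ + Ξ(·+i) + Ξ(·−i)` has
only real zeros" and `X := PencilUnbounded` (the route target: hyperbolic rungs of unbounded weight).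

Kernel-checked facts assembled here (no `sorry`, standard axioms):

* `displacementPencil_hurwitzTransfer` — the route's support item `HurwitzTransfer`
  (stmt-RiemannHypothesis-17889) holds: hyperbolic rungs along `c_k ≥ 4·2^k` force `Ξ` hyperbolic
  (the Hurwitz argument of the route's `closes`, extracted as a theorem).
* `displacementPencil_riemannHypothesis_of_pencilUnbounded` — `X → RiemannHypothesis`: the TARGET ALONE
  already gives the summit (choose rungs `≥ 4·2^k` from unboundedness; Hurwitz; Riemann's `Ξ`-form).
* `displacementPencil_pencilDoubling_of_pencilUnbounded` — `X → PencilDoubling` in one line.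
* `displacementPencil_pencilDoubling_iff` — `PencilDoubling ↔ (∀ c ≥ 4, ¬Hyp c) ∨ X`: the crux is the
  target OR the vacuous disjunct "no rung of weight ≥ 4 is hyperbolic".
* `displacementPencil_pencilDoubling_iff_pencilUnbounded_of_rung` /
  `displacementPencil_pencilDoubling_iff_pencilUnbounded_of_pencilBase` — given ANY hyperbolic rung
  `c₀ ≥ 4` (in particular the route's co-crux `PencilBase`, `c₀ = 4`) the crux is LITERALLY EQUIVALENT
  to the target `X`.
* `displacementPencil_costume` — the one-line summary used by the census:
  `PencilBase → ((PencilDoubling ↔ PencilUnbounded) ∧ (PencilUnbounded → RiemannHypothesis))`.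

Reading.  Modulo the co-crux the deciding crux is not a cut strictly below the summit: it IS the
target `X`, `X ⇒ RH` is proved here, and the converse `RH ⇒ X` is not only open (route item
`RHImpliesPencil`, "open-problem") but NUMERICALLY FALSE: close-pair flooding gives `P_c` certified
non-real zero pairs for every tested `c ∈ [215, 65536]` (refuter evidence CERTIFIED-ZEROS.md /
FLOODING.md on the item, kit j023033 / j023122), so on that evidence `X` fails, and with any hyperbolic
rung in `[4, 184]` the crux fails too (`displacementPencil_not_pencilDoubling_iff`, landed p144764).
-/

noncomputable section

set_option linter.dupNamespace false

namespace Summit.RiemannHypothesis.RiemannHypothesis.Theorems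

open Literature.NumberTheory.LFunctions
open Summit.RiemannHypothesis.RiemannHypothesis.Theses.DisplacementPencil

/-- The route's support item `HurwitzTransfer` (stmt-RiemannHypothesis-17889): if `P_{c_k}` has only
real zeros along a sequence `c_k ≥ 4·2^k` then `Ξ` has only real zeros (`P_{c_k}/c_k → Ξ` locally
uniformly, the rungs are zero-free off the axis, Hurwitz, `Ξ(i/2) = ξ(0) = 1/2 ≠ 0`).  Proof = the
Hurwitz block of the route's `closes`, verbatim. [Conway1978; tree `Complex.hurwitz_eqOn_zero_or_forall_ne_zero`] -/
theorem displacementPencil_hurwitzTransfer : HurwitzTransfer := by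
  classical
  intro c hc hreal z₀ hz₀
  by_contra him
  have hΞd : Differentiable ℂ Literature.NumberTheory.LFunctions.riemannXiUpper := by
    intro z
    unfold Literature.NumberTheory.LFunctions.riemannXiUpper
    have h : Differentiable ℂ (fun z : ℂ => (1 / 2 : ℂ) + Complex.I * z) :=
      (differentiable_const _).add (differentiable_id.const_mul _)
    exact (Literature.NumberTheory.LFunctions.differentiable_riemannXi.comp h) z
  have hΞval : Literature.NumberTheory.LFunctions.riemannXiUpper (Complex.I / 2) = 1 / 2 := by
    unfold Literature.NumberTheory.LFunctions.riemannXiUpper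
    have : (1 / 2 : ℂ) + Complex.I * (Complex.I / 2) = 0 := by
      rw [mul_div_assoc', Complex.I_mul_I]; ring
    rw [this, Literature.NumberTheory.LFunctions.riemannXi_zero]
  set r : ℝ := |z₀.im| / 2 with hr
  have hrpos : 0 < r := by
    have : 0 < |z₀.im| := abs_pos.mpr him
    positivity
  set U : Set ℂ := Metric.ball z₀ r with hU
  have hUopen : IsOpen U := Metric.isOpen_ball
  have hUconn : IsPreconnected U := (convex_ball z₀ r).isPreconnected
  have hz₀U : z₀ ∈ U := Metric.mem_ball_self hrpos
  have hUim : ∀ z ∈ U, z.im ≠ 0 := by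
    intro z hz h0
    have hdist : dist z z₀ < r := Metric.mem_ball.mp hz
    have h1 : |z.im - z₀.im| ≤ dist z z₀ := by
      rw [Complex.dist_eq]
      simpa using Complex.abs_im_le_norm (z - z₀)
    rw [h0, zero_sub, abs_neg] at h1
    have : |z₀.im| < |z₀.im| / 2 := lt_of_le_of_lt h1 hdist
    linarith [abs_nonneg z₀.im]
  set g : ℂ → ℂ := fun z => Literature.NumberTheory.LFunctions.riemannXiUpper (z + Complex.I) +
    Literature.NumberTheory.LFunctions.riemannXiUpper (z - Complex.I) with hg
  have hgcont : Continuous g := by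
    have hΞ := hΞd.continuous
    exact (hΞ.comp (continuous_id.add continuous_const)).add
      (hΞ.comp (continuous_id.sub continuous_const))
  obtain ⟨M, hM⟩ : ∃ M : ℝ, ∀ z ∈ Metric.closedBall z₀ r, ‖g z‖ ≤ M := by
    have hK : IsCompact (Metric.closedBall z₀ r) := isCompact_closedBall _ _
    obtain ⟨M, hM⟩ := hK.exists_bound_of_continuousOn hgcont.continuousOn
    exact ⟨M, hM⟩
  have hcpos : ∀ k, 0 < c k := fun k => lt_of_lt_of_le (by positivity) (hc k)
  set F : ℕ → ℂ → ℂ := fun k z =>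
    Literature.NumberTheory.LFunctions.riemannXiUpper z + (c k : ℂ)⁻¹ * g z with hF
  have hFdiff : ∀ᶠ k in Filter.atTop, DifferentiableOn ℂ (F k) U := by
    refine Filter.Eventually.of_forall fun k => ?_
    have hgd : Differentiable ℂ g :=
      (hΞd.comp (differentiable_id.add (differentiable_const _))).add
        (hΞd.comp (differentiable_id.sub (differentiable_const _)))
    exact (hΞd.add (hgd.const_mul _)).differentiableOn
  have hunif : TendstoUniformlyOn F Literature.NumberTheory.LFunctions.riemannXiUpper
      Filter.atTop U := by
    rw [Metric.tendstoUniformlyOn_iff]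
    intro ε hε
    obtain ⟨k₀, hk₀⟩ : ∃ k₀ : ℕ, M < ε * (4 * 2 ^ k₀) := by
      obtain ⟨k₀, hk₀⟩ := pow_unbounded_of_one_lt (M / (4 * ε) + 1) (by norm_num : (1 : ℝ) < 2)
      refine ⟨k₀, ?_⟩
      have h4ε : 0 < 4 * ε := by positivity
      have : M / (4 * ε) < 2 ^ k₀ := by linarith
      rw [div_lt_iff₀ h4ε] at this
      linarith
    refine Filter.eventually_atTop.mpr ⟨k₀, fun k hk z hz => ?_⟩
    have hzc : z ∈ Metric.closedBall z₀ r := Metric.ball_subset_closedBall hz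
    have hck : (4 : ℝ) * 2 ^ k₀ ≤ c k := le_trans
      (mul_le_mul_of_nonneg_left (pow_le_pow_right₀ (by norm_num) hk) (by norm_num)) (hc k)
    have hckpos : 0 < c k := hcpos k
    rw [dist_eq_norm]
    have : Literature.NumberTheory.LFunctions.riemannXiUpper z - F k z = -((c k : ℂ)⁻¹ * g z) := by
      simp [hF]
    rw [this, norm_neg, norm_mul, norm_inv, Complex.norm_real, Real.norm_eq_abs,
      abs_of_pos hckpos]
    calc (c k)⁻¹ * ‖g z‖ ≤ (c k)⁻¹ * M := by
            exact mul_le_mul_of_nonneg_left (hM z hzc) (inv_nonneg.mpr hckpos.le)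
      _ < ε := by
            rw [inv_mul_lt_iff₀ hckpos]
            calc M < ε * (4 * 2 ^ k₀) := hk₀
              _ ≤ ε * c k := by exact mul_le_mul_of_nonneg_left hck hε.le
              _ = c k * ε := by ring
  have hlim : TendstoLocallyUniformlyOn F Literature.NumberTheory.LFunctions.riemannXiUpper
      Filter.atTop U := hunif.tendstoLocallyUniformlyOn
  have hzero : ∃ᶠ k in Filter.atTop, ∀ z ∈ U, F k z ≠ 0 := by
    refine Filter.Frequently.of_forall fun k => ?_
    intro z hz hFz
    have hck : (c k : ℂ) ≠ 0 := by exact_mod_cast (hcpos k).ne'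
    have hP : (c k : ℂ) * Literature.NumberTheory.LFunctions.riemannXiUpper z +
        Literature.NumberTheory.LFunctions.riemannXiUpper (z + Complex.I) +
        Literature.NumberTheory.LFunctions.riemannXiUpper (z - Complex.I) = 0 := by
      have : (c k : ℂ) * F k z = 0 := by rw [hFz, mul_zero]
      have h2 : (c k : ℂ) * F k z =
          (c k : ℂ) * Literature.NumberTheory.LFunctions.riemannXiUpper z + g z := by
        simp only [hF]; field_simp
      rw [h2] at this
      simpa [hg, add_assoc] using this
    exact hUim z hz (hreal k z hP)
  rcases Complex.hurwitz_eqOn_zero_or_forall_ne_zero hUopen hUconn hFdiff hlim hzero with h | h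
  · have han : AnalyticOnNhd ℂ Literature.NumberTheory.LFunctions.riemannXiUpper Set.univ :=
      (hΞd.differentiableOn.analyticOnNhd isOpen_univ)
    have hev : ∀ᶠ z in nhds z₀, Literature.NumberTheory.LFunctions.riemannXiUpper z = 0 := by
      filter_upwards [hUopen.mem_nhds hz₀U] with z hz using h hz
    have hall := han.eqOn_zero_of_preconnected_of_eventuallyEq_zero isPreconnected_univ
      (Set.mem_univ z₀) hev
    have := hall (Set.mem_univ (Complex.I / 2))
    rw [hΞval] at this
    norm_num at this
  · exact h z₀ hz₀U hz₀

/-- The route TARGET alone gives the summit: `PencilUnbounded → RiemannHypothesis`.  Choose, for each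
`k`, a hyperbolic rung of weight `≥ 4·2^k`; apply `HurwitzTransfer`; conclude by Riemann's `Ξ`-form of RH
(`riemannHypothesis_iff_im_eq_zero_of_riemannXiUpper_eq_zero_holds`) and `Summit.RiemannHypothesis_iff`.
[Conway1978, Bruijn1950] -/
theorem displacementPencil_riemannHypothesis_of_pencilUnbounded (hX : PencilUnbounded) :
    _root_.Summit.RiemannHypothesis := by
  classical
  choose c hc hreal using fun k : ℕ => hX ((4 : ℝ) * 2 ^ k)
  have hΞ : HasOnlyRealZeros riemannXiUpper := displacementPencil_hurwitzTransfer c hc hreal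
  exact (_root_.Summit.RiemannHypothesis_iff).2
    ((riemannHypothesis_iff_im_eq_zero_of_riemannXiUpper_eq_zero_holds).2 hΞ)

/-- The target gives the crux in one line (take `c' := 2c`). [folklore] -/
theorem displacementPencil_pencilDoubling_of_pencilUnbounded (hX : PencilUnbounded) : PencilDoubling :=
  fun c _ _ => hX (2 * c)

/-- The vacuous disjunct gives the crux: if NO rung of weight `≥ 4` is hyperbolic, `PencilDoubling`
holds trivially. [folklore] -/
theorem displacementPencil_pencilDoubling_of_noRung
    (hno : ∀ c : ℝ, 4 ≤ c → ¬ HasOnlyRealZeros (fun z : ℂ => (c : ℂ) * riemannXiUpper z +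
      riemannXiUpper (z + Complex.I) + riemannXiUpper (z - Complex.I))) : PencilDoubling :=
  fun c hc hyp => absurd hyp (hno c hc)

/-- LOGICAL SHAPE of the crux as filed: `PencilDoubling ↔ (no hyperbolic rung of weight ≥ 4) ∨ TARGET`.
(Positive form of the landed `displacementPencil_not_pencilDoubling_iff`.) [folklore] -/
theorem displacementPencil_pencilDoubling_iff :
    PencilDoubling ↔
      (∀ c : ℝ, 4 ≤ c → ¬ HasOnlyRealZeros (fun z : ℂ => (c : ℂ) * riemannXiUpper z +
        riemannXiUpper (z + Complex.I) + riemannXiUpper (z - Complex.I))) ∨ PencilUnbounded := by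
  constructor
  · intro h
    by_contra hcon
    obtain ⟨hno, hX⟩ := not_or.mp hcon
    apply hno
    intro c hc hyp
    exact displacementPencil_not_pencilDoubling_of_rung_of_not_pencilUnbounded hc hyp hX h
  · rintro (hno | hX)
    · exact displacementPencil_pencilDoubling_of_noRung hno
    · exact displacementPencil_pencilDoubling_of_pencilUnbounded hX

/-- Given ANY hyperbolic rung `c₀ ≥ 4`, the crux is literally the target. [folklore] -/
theorem displacementPencil_pencilDoubling_iff_pencilUnbounded_of_rung {c₀ : ℝ} (h4 : 4 ≤ c₀)
    (h₀ : HasOnlyRealZeros (fun z : ℂ => (c₀ : ℂ) * riemannXiUpper z + riemannXiUpper (z + Complex.I) +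
      riemannXiUpper (z - Complex.I))) :
    PencilDoubling ↔ PencilUnbounded := by
  constructor
  · intro h
    by_contra hX
    exact displacementPencil_not_pencilDoubling_of_rung_of_not_pencilUnbounded h4 h₀ hX h
  · exact displacementPencil_pencilDoubling_of_pencilUnbounded

/-- With the route's co-crux `PencilBase` (the rung `c₀ = 4`), the deciding crux `PencilDoubling` is
EQUIVALENT to the route target `PencilUnbounded`. [folklore] -/
theorem displacementPencil_pencilDoubling_iff_pencilUnbounded_of_pencilBase (hbase : PencilBase) :
    PencilDoubling ↔ PencilUnbounded := by
  have h₀ := hbase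
  unfold PencilBase at h₀
  exact displacementPencil_pencilDoubling_iff_pencilUnbounded_of_rung le_rfl (by simpa using h₀)

/-- COSTUME THEOREM (census one-liner): modulo the co-crux, the deciding crux IS the target, and the
target alone implies the summit. [folklore] -/
theorem displacementPencil_costume (hbase : PencilBase) :
    (PencilDoubling ↔ PencilUnbounded) ∧ (PencilUnbounded → _root_.Summit.RiemannHypothesis) :=
  ⟨displacementPencil_pencilDoubling_iff_pencilUnbounded_of_pencilBase hbase,
    displacementPencil_riemannHypothesis_of_pencilUnbounded⟩

end Summit.RiemannHypothesis.RiemannHypothesis.Theorems
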